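import Literature.MathematicalPhysics.QuantumFieldTheory.Sweep1
import Literature.MathematicalPhysics.QuantumFieldTheory.AdhikariCao2022.CorrelationDecay
import Literature.MathematicalPhysics.QuantumFieldTheory.YangMillsOSNonempty
import Literature.MathematicalPhysics.QuantumFieldTheory.Sweep1AreaLawProofs
import Literature.MathematicalPhysics.QuantumFieldTheory.StrongCouplingClustering
import HarnessLib

/-!
# LINE L2 (ym-idea-4 g5, «spectral / trace methods») — LANDED PART: the registered strong hypothesis
`ChatterjeeMassGapProblem` (cqft.S28, wave-0 transcription; `Literature/StrongHypotheses/QuantumFields`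
row 6) is REFUTABLE AS TYPED from the named fact `AdhikariCao2022.correlationDecay`

This file is sorry-free: four of the five lemmas of the line are PROVED here
(`exists_finite_nonabelian_model`, `exists_isInfiniteVolumeLimit_of_discrete`,
`abs_plaquetteCorrelation_le_of_eventually`, `le_inv_corrLength_of_axial_decay`) and the reduction
`not_chatterjeeMassGapProblem_of_boxDecay` is kernel-checked: the ONLY remaining input is the
DICTIONARY hypothesis `hB` (Sweep1's free-boundary `zdWilsonMeasure ρ β (box 4 L)` for a finite gauge
group is Adhikari–Cao's `μ_{Λ,β}`; their Theorem 1.1 then bounds the plaquette–plaquette covariance),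
spelled out inline as the first binder.  Target decl BY NAME:
`¬ Literature.MathematicalPhysics.QuantumFieldTheory.ChatterjeeMassGapProblem` under
`(hAC : Literature.MathematicalPhysics.QuantumFieldTheory.AdhikariCao2022.correlationDecay)` and `hB`.

WHY.  The typed `∀` ranges over every compact group with a faithful continuous unitary
`N`-dimensional representation and two non-commuting elements — this includes FINITE non-abelian
groups (`S₃ ⊂ U(3)` by permutation matrices).  For a finite gauge group Adhikari–Cao (Thm 1.1, free
boundary conditions on cubes — exactly the `IsInfiniteVolumeLimit` setting of the decl) give, for
`β ≥ (114 + 4 log|G|)/Δ_G`, `|f_β(x)| ≤ C_G e^{−(β/2)Δ_G(‖x‖_∞ − 2)}` uniformly in the cube, hence in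
every infinite-volume limit; along the axis the demanded Euclidean rate `−1/ξ(β, μ)` is then
`≤ −(β/2)Δ_G`, i.e. `ξ(β, μ) ≤ 2/(βΔ_G) → 0`, contradicting the decl's clause `ξ(β, μ) → ∞`
(discrete groups FREEZE: the positive-mirror/negative-mirror pair with LINE L1 and with the barrier
`Literature.Barriers.QuantumFields.zn_not_divergentCorrLength`, which does the abelian `ℤ_n` torus case).
This is a STATEMENT-HYGIENE line (instrument row: registry rows 5/6 should quantify over compact
connected simple `G` — `IsCompactSimpleLieGroup` — and use an axial `HasInvCorrLength` rate); it
proves no summit and says nothing about `SU(N)`.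

Proved here: the instance (`S₃ ⊂ U(3)` by permutation matrices, `Δ_{S₃} = 3 − 1 = 2 > 0`, via
`Matrix.trace_permutation`), existence of a free-b.c. infinite-volume limit for a finite gauge group
(compactness of `ProbabilityMeasure (ZdGaugeConfig 4 G)` + `isProbabilityMeasure_zdWilsonMeasure`;
torus twin `infiniteVolumeLimitPoints_nonempty_holds`), the weak-limit passage of the plaquette
covariance (`covariance_eq_sub` on bounded continuous observables), and the axis-rate comparison
(`latticeNorm (n e₀) = n`).  Remaining (hypothesis `hB`, size M/L): the dictionary + Adhikari–Cao.
No summit is proved; nothing is said about `SU(N)`.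

References: A. Adhikari, S. Cao, *Correlation decay for finite lattice gauge theories at weak
coupling*, Ann. Probab. 53 (2025), arXiv:2202.10375, Thm 1.1; S. Chatterjee, arXiv:1803.01950, §5
Problem 5.1; E. Seiler, LNP 159 (1982) Ch. 2.
-/

noncomputable section

open MeasureTheory ProbabilityTheory Filter Topology
open Literature.MathematicalPhysics.QuantumFieldTheory
open Literature.MathematicalPhysics.QuantumFieldTheory.AdhikariCao2022 (correlationDecay deltaG)
open Literature.Probability.LatticeModels (Site box)

namespace Summit.QuantumFields.YangMills.Theorems.NotChatterjeeMassGap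

/-! ### The four proved lemmas -/

/-- **(I) A finite non-abelian gauge group inside `U(3)` with positive Adhikari–Cao gap `Δ_G`:**
`S₃` by `3 × 3` permutation matrices (`Δ = 2`).  It satisfies every hypothesis of the typed `∀` of
`ChatterjeeMassGapProblem`. [folklore] -/
theorem exists_finite_nonabelian_model :
  ∃ (G : Type) (_ : Group G) (_ : Fintype G) (_ : TopologicalSpace G) (_ : DiscreteTopology G)
    (_ : IsTopologicalGroup G) (_ : CompactSpace G) (_ : MeasurableSpace G) (_ : BorelSpace G)
    (N : ℕ) (ρ : G →* Matrix (Fin N) (Fin N) ℂ),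
    2 ≤ N ∧ Continuous ρ ∧ Function.Injective ρ ∧ (∀ g : G, ρ g ∈ Matrix.unitaryGroup (Fin N) ℂ) ∧
      (∃ g h : G, g * h ≠ h * g) ∧ 0 < deltaG ρ := by
  classical
  letI : TopologicalSpace (Equiv.Perm (Fin 3)) := ⊥
  haveI : DiscreteTopology (Equiv.Perm (Fin 3)) := ⟨rfl⟩
  haveI : IsTopologicalGroup (Equiv.Perm (Fin 3)) :=
    { continuous_mul := continuous_of_discreteTopology
      continuous_inv := continuous_of_discreteTopology }
  letI : MeasurableSpace (Equiv.Perm (Fin 3)) := ⊤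
  haveI : BorelSpace (Equiv.Perm (Fin 3)) := ⟨(borel_eq_top_of_discrete).symm⟩
  haveI : CompactSpace (Equiv.Perm (Fin 3)) := Finite.compactSpace
  let ρ : Equiv.Perm (Fin 3) →* Matrix (Fin 3) (Fin 3) ℂ := Matrix.permMatrixHom
  refine ⟨Equiv.Perm (Fin 3), inferInstance, inferInstance, inferInstance, inferInstance,
    inferInstance, inferInstance, inferInstance, inferInstance, 3, ρ, by norm_num,
    continuous_of_discreteTopology, LatticeRep.permMatrixHom_injective, fun g => ?_,
    ⟨Equiv.swap 0 1, Equiv.swap 1 2, by decide⟩, ?_⟩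
  · simpa [ρ, Matrix.permMatrixHom_apply] using LatticeRep.permMatrix_mem_unitaryGroup g⁻¹
  · -- `0 < Δ_G = 3 − max_{g ≠ 1} #Fix(g) = 2`
    have key : ∀ σ : Equiv.Perm (Fin 3), σ ≠ 1 → (Finset.univ.filter fun i => σ i = i).card ≤ 1 := by
      decide
    have hfix : ∀ σ : Equiv.Perm (Fin 3), σ ≠ 1 → (Function.fixedPoints σ).ncard ≤ 1 := by
      intro σ hσ
      have hset : Function.fixedPoints (σ : Fin 3 → Fin 3) =
          ↑(Finset.univ.filter fun i => σ i = i) := by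
        ext i; simp [Function.fixedPoints, Function.IsFixedPt]
      rw [hset, Set.ncard_coe_finset]
      exact key σ hσ
    haveI : Nonempty {g : Equiv.Perm (Fin 3) // g ≠ 1} := ⟨⟨Equiv.swap 0 1, by decide⟩⟩
    obtain ⟨g₀, hg₀⟩ := exists_eq_ciInf_of_finite
      (f := fun g : {g : Equiv.Perm (Fin 3) // g ≠ 1} =>
        (AdhikariCao2022.character ρ 1 - AdhikariCao2022.character ρ (g : Equiv.Perm (Fin 3))).re)
    show 0 < ⨅ g : {g : Equiv.Perm (Fin 3) // g ≠ 1},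
      (AdhikariCao2022.character ρ 1 - AdhikariCao2022.character ρ (g : Equiv.Perm (Fin 3))).re
    rw [← hg₀]
    have h1 : AdhikariCao2022.character ρ 1 = 3 := by
      simp [AdhikariCao2022.character, Matrix.trace_one]
    have hg : AdhikariCao2022.character ρ (g₀ : Equiv.Perm (Fin 3)) =
        ((Function.fixedPoints ((g₀ : Equiv.Perm (Fin 3))⁻¹ : Equiv.Perm (Fin 3))).ncard : ℂ) := by
      simp [AdhikariCao2022.character, ρ, Matrix.permMatrixHom_apply, Matrix.trace_permutation]
    have hne : ((g₀ : Equiv.Perm (Fin 3))⁻¹ : Equiv.Perm (Fin 3)) ≠ 1 := by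
      simpa using g₀.2
    have hle : ((Function.fixedPoints ((g₀ : Equiv.Perm (Fin 3))⁻¹ : Equiv.Perm (Fin 3))).ncard : ℝ)
        ≤ 1 := by exact_mod_cast hfix _ hne
    rw [h1, hg, Complex.sub_re, Complex.natCast_re]
    have h3 : (3 : ℂ).re = 3 := by norm_num
    rw [h3]
    linarith
/-- **(E) Existence of a free-b.c. infinite-volume limit (`IsInfiniteVolumeLimit`) for a finite
(discrete) gauge group, at every `β`:** compactness and metrisability of
`ProbabilityMeasure (ZdGaugeConfig 4 G)` (Lévy–Prokhorov) give a weakly convergent subsequence of the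
free-boundary states on the cubes `box 4 L`. [cite: arXiv180301950, §2–3] -/
theorem exists_isInfiniteVolumeLimit_of_discrete :
  ∀ (G : Type) [Group G] [Fintype G] [TopologicalSpace G] [DiscreteTopology G] [IsTopologicalGroup G]
    [CompactSpace G] [MeasurableSpace G] [BorelSpace G] (N : ℕ) (ρ : G →* Matrix (Fin N) (Fin N) ℂ)
    (β : ℝ), ∃ μ : Measure (ZdGaugeConfig 4 G), IsInfiniteVolumeLimit ρ β μ := by
  intro G _ _ _ _ _ _ _ _ N ρ β
  have hρ : Continuous ρ := continuous_of_discreteTopology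
  haveI := fun L : ℕ => isProbabilityMeasure_zdWilsonMeasure (d := 4) ρ hρ β (box 4 L)
  let P : ℕ → ProbabilityMeasure (ZdGaugeConfig 4 G) := fun L =>
    ⟨zdWilsonMeasure ρ β (box 4 L), inferInstance⟩
  obtain ⟨μ, -, φ, hφ, hlim⟩ :=
    (isCompact_univ (X := ProbabilityMeasure (ZdGaugeConfig 4 G))).tendsto_subseq
      fun n => Set.mem_univ (P n)
  refine ⟨(μ : Measure (ZdGaugeConfig 4 G)), inferInstance, φ, hφ, fun f hfc hfb => ?_⟩
  obtain ⟨C, hC⟩ := hfb.exists_norm_le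
  let Fb : BoundedContinuousFunction (ZdGaugeConfig 4 G) ℝ :=
    BoundedContinuousFunction.ofNormedAddCommGroup f hfc C (fun U => hC _ (Set.mem_range_self U))
  exact (ProbabilityMeasure.tendsto_iff_forall_integral_tendsto.1 hlim) Fb
/-- Plaquette observables are continuous for continuous `ρ`. [folklore] -/
theorem continuous_zdPlaquetteObs {G : Type} [Group G] [TopologicalSpace G] [IsTopologicalGroup G]
    {N : ℕ} (ρ : G →* Matrix (Fin N) (Fin N) ℂ) (hρ : Continuous ρ) (x : Site 4) (i j : Fin 4) :
    Continuous (zdPlaquetteObs (d := 4) ρ x i j) := by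
  unfold zdPlaquetteObs
  exact continuous_const.mul
    (Complex.continuous_re.comp ((hρ.comp (AreaLaw.continuous_plaquette x i j)).matrix_trace))

/-- **(W) Weak-limit passage:** an eventual (in the cube size) bound on the free-boundary finite-volume
plaquette–plaquette covariance is inherited by the infinite-volume correlation
`plaquetteCorrelation ρ μ x` of every `IsInfiniteVolumeLimit` state (bounded continuous observables;
`covariance_eq_sub`). [folklore] -/
theorem abs_plaquetteCorrelation_le_of_eventually :
  ∀ (G : Type) [Group G] [TopologicalSpace G] [IsTopologicalGroup G] [CompactSpace G]
    [SecondCountableTopology G] [MeasurableSpace G] [BorelSpace G] (N : ℕ) (ρ : G →* Matrix (Fin N) (Fin N) ℂ), Continuous ρ →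
    ∀ (β : ℝ) (μ : Measure (ZdGaugeConfig 4 G)), IsInfiniteVolumeLimit ρ β μ →
    ∀ (x : Site 4) (K : ℝ), (∀ᶠ L : ℕ in atTop,
      |zdExpect ρ β (box 4 L) (fun U => zdPlaquetteObs ρ 0 0 1 U * zdPlaquetteObs ρ x 0 1 U) -
        zdExpect ρ β (box 4 L) (zdPlaquetteObs ρ 0 0 1) * zdExpect ρ β (box 4 L) (zdPlaquetteObs ρ x 0 1)|
        ≤ K) → |plaquetteCorrelation ρ μ x| ≤ K := by
  intro G _ _ _ _ _ _ _ N ρ hρ β μ hμ x K hK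
  obtain ⟨hprob, φ, hφ, hconv⟩ := hμ
  set X : ZdGaugeConfig 4 G → ℝ := zdPlaquetteObs ρ 0 0 1 with hXdef
  set Y : ZdGaugeConfig 4 G → ℝ := zdPlaquetteObs ρ x 0 1 with hYdef
  have hXc : Continuous X := continuous_zdPlaquetteObs ρ hρ 0 0 1
  have hYc : Continuous Y := continuous_zdPlaquetteObs ρ hρ x 0 1
  have hbdd : ∀ f : ZdGaugeConfig 4 G → ℝ, Continuous f → Bornology.IsBounded (Set.range f) :=
    fun f hf => (isCompact_range hf).isBounded
  have h1 := hconv (fun U => X U * Y U) (hXc.mul hYc) (hbdd _ (hXc.mul hYc))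
  have h2 := hconv X hXc (hbdd _ hXc)
  have h3 := hconv Y hYc (hbdd _ hYc)
  have hlim : Tendsto (fun k => zdExpect ρ β (box 4 (φ k)) (fun U => zdPlaquetteObs ρ 0 0 1 U * zdPlaquetteObs ρ x 0 1 U) -
        zdExpect ρ β (box 4 (φ k)) (zdPlaquetteObs ρ 0 0 1) * zdExpect ρ β (box 4 (φ k)) (zdPlaquetteObs ρ x 0 1)) atTop
      (𝓝 ((∫ U, X U * Y U ∂μ) - (∫ U, X U ∂μ) * ∫ U, Y U ∂μ)) := h1.sub (h2.mul h3)
  obtain ⟨CX, hCX⟩ := (hbdd _ hXc).exists_norm_le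
  obtain ⟨CY, hCY⟩ := (hbdd _ hYc).exists_norm_le
  have hXm : MemLp X 2 μ := MemLp.of_bound hXc.measurable.aestronglyMeasurable CX
    (ae_of_all _ fun U => hCX _ (Set.mem_range_self U))
  have hYm : MemLp Y 2 μ := MemLp.of_bound hYc.measurable.aestronglyMeasurable CY
    (ae_of_all _ fun U => hCY _ (Set.mem_range_self U))
  have hcov : plaquetteCorrelation ρ μ x = (∫ U, X U * Y U ∂μ) - (∫ U, X U ∂μ) * ∫ U, Y U ∂μ := by
    unfold plaquetteCorrelation
    rw [← hXdef, ← hYdef, covariance_eq_sub hXm hYm]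
    rfl
  have hev := hφ.tendsto_atTop.eventually hK
  rw [hcov]
  exact le_of_tendsto hlim.abs hev
/-- **(R) Axis-rate comparison:** an exponential upper bound `|f(n e₀)| ≤ K e^{−c(n−2)}` along the
axis forces Chatterjee's Euclidean rate `−1/ξ` (cofinite limit of `log f(x)/|x|`) to satisfy
`c ≤ 1/ξ`, i.e. `ξ ≤ 1/c` (`latticeNorm (n e₀) = n`). [folklore] -/
theorem le_inv_corrLength_of_axial_decay :
  ∀ (f : Site 4 → ℝ) (K c ξ : ℝ), 0 < c → 0 < ξ →
    (∀ n : ℕ, 2 ≤ n → |f (Pi.single (0 : Fin 4) (n : ℤ))| ≤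
      K * Real.exp (-(c * ((n : ℝ) - 2)))) →
    (∀ᶠ x in cofinite, 0 < f x) →
    Tendsto (fun x => Real.log (f x) / latticeNorm x) cofinite (𝓝 (-1 / ξ)) → c ≤ 1 / ξ := by
  intro f K c ξ hc hξ hK hpos hlim
  have hinj : Function.Injective (fun n : ℕ => (Pi.single (0 : Fin 4) (n : ℤ) : Site 4)) := by
    intro m n h
    have := congrArg (fun x : Site 4 => x 0) h
    simpa using this
  have hax : Tendsto (fun n : ℕ => (Pi.single (0 : Fin 4) (n : ℤ) : Site 4)) atTop cofinite := by
    rw [← Nat.cofinite_eq_atTop]; exact hinj.tendsto_cofinite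
  have hnorm : ∀ n : ℕ, latticeNorm ((Pi.single (0 : Fin 4) (n : ℤ) : Site 4)) = n := by
    intro n
    unfold latticeNorm
    have : (WithLp.toLp 2 fun i => (((Pi.single (0 : Fin 4) (n : ℤ) : Site 4) i : ℤ) : ℝ)) =
        EuclideanSpace.single (0 : Fin 4) (n : ℝ) := by
      ext i
      by_cases hi : i = 0
      · subst hi; simp
      · simp [hi]
    rw [this, PiLp.norm_single]; simp
  have hlim' : Tendsto (fun n : ℕ => Real.log (f (Pi.single (0 : Fin 4) (n : ℤ))) / n)
      atTop (𝓝 (-1 / ξ)) := by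
    have := hlim.comp hax
    refine this.congr' (Eventually.of_forall fun n => ?_)
    simp only [Function.comp_def, hnorm]
  have hpos' : ∀ᶠ n : ℕ in atTop, 0 < f (Pi.single (0 : Fin 4) (n : ℤ)) :=
    hax.eventually hpos
  obtain ⟨n₀, hn₀⟩ := (hpos'.and (eventually_ge_atTop 2)).exists
  have hKpos : 0 < K := by
    have h1 := hK n₀ hn₀.2
    have h2 : 0 < |f (Pi.single (0 : Fin 4) (n₀ : ℤ))| := abs_pos.2 hn₀.1.ne'
    exact (mul_pos_iff_of_pos_right (Real.exp_pos _)).1 (lt_of_lt_of_le h2 h1)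
  have hup : Tendsto (fun n : ℕ => (Real.log K - c * ((n:ℝ) - 2)) / n) atTop (𝓝 (-c)) := by
    have e1 : (fun n : ℕ => (Real.log K - c * ((n:ℝ) - 2)) / n) =ᶠ[atTop]
        fun n => (Real.log K + 2 * c) / n - c := by
      filter_upwards [eventually_ge_atTop 1] with n hn
      have : (n:ℝ) ≠ 0 := by positivity
      field_simp; ring
    rw [tendsto_congr' e1]
    simpa using (tendsto_const_div_atTop_nhds_zero_nat (Real.log K + 2 * c)).sub_const c
  have hle : ∀ᶠ n : ℕ in atTop,
      Real.log (f (Pi.single (0 : Fin 4) (n : ℤ))) / n ≤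
        (Real.log K - c * ((n:ℝ) - 2)) / n := by
    filter_upwards [hpos', eventually_ge_atTop 2] with n hn h2
    have hn' : (0:ℝ) < n := by exact_mod_cast (by omega : 0 < n)
    apply div_le_div_of_nonneg_right _ hn'.le
    have hb := hK n h2
    rw [abs_of_pos hn] at hb
    calc Real.log (f (Pi.single (0 : Fin 4) (n : ℤ)))
        ≤ Real.log (K * Real.exp (-(c * ((n:ℝ) - 2)))) :=
          Real.log_le_log hn hb
      _ = Real.log K - c * ((n:ℝ) - 2) := by
          rw [Real.log_mul hKpos.ne' (Real.exp_pos _).ne', Real.log_exp]; ring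
  have := le_of_tendsto_of_tendsto hlim' hup hle
  rw [neg_div] at this
  linarith
/-! ### The reduction -/

/-- **LINE L2 reduction (kernel-checked).** Given the DICTIONARY + Adhikari–Cao bound `hB` — for a
finite gauge group with unitary `ρ` and `β ≥ (114 + 4 log|G|)/Δ_G`, the free-boundary plaquette–plaquette
covariance on the cube `box 4 L` at axial separation `n ≥ 2` (`L ≥ n + 1`) is at most
`4(4·10²⁴|G|²)² e^{−(β/2)Δ_G(n−2)}` (Adhikari–Cao Thm 1.1 with `B₁, B₂` the two unit squares,
`k₁ = k₂ = 1`, `f = (1/N) Re χ`, `ℓ^∞`-distance `≥ n − 1`) — and the named fact `correlationDecay`,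
the registered statement `ChatterjeeMassGapProblem` is FALSE AS TYPED: `S₃ ⊂ U(3)` freezes,
`ξ(β, μ) ≤ 2/(βΔ) → 0`.  Statement hygiene, not physics of `SU(N)`; no summit is proved.
[cite: AdhikariCao2025, Thm 1.1] [cite: arXiv180301950, §5 Problem 5.1] -/
theorem not_chatterjeeMassGapProblem_of_boxDecay
    (hB : correlationDecay →
      ∀ (G : Type) [Group G] [Fintype G] [TopologicalSpace G] [DiscreteTopology G]
        [IsTopologicalGroup G] [CompactSpace G] [MeasurableSpace G] [BorelSpace G] (N : ℕ)
        (ρ : G →* Matrix (Fin N) (Fin N) ℂ), (∀ g : G, ρ g ∈ Matrix.unitaryGroup (Fin N) ℂ) →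
        ∀ β : ℝ, 114 + 4 * Real.log (Fintype.card G) ≤ deltaG ρ * β →
        ∀ n : ℕ, 2 ≤ n → ∀ L : ℕ, n + 1 ≤ L →
          |zdExpect ρ β (box 4 L) (fun U => zdPlaquetteObs ρ 0 0 1 U *
                zdPlaquetteObs ρ (Pi.single (0 : Fin 4) (n : ℤ)) 0 1 U) -
              zdExpect ρ β (box 4 L) (zdPlaquetteObs ρ 0 0 1) *
                zdExpect ρ β (box 4 L) (zdPlaquetteObs ρ (Pi.single (0 : Fin 4) (n : ℤ)) 0 1)| ≤
            4 * (4 * 10 ^ 24 * (Fintype.card G : ℝ) ^ 2) ^ 2 *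
              Real.exp (-(β / 2) * deltaG ρ * ((n : ℝ) - 2)))
    (hAC : correlationDecay) : ¬ ChatterjeeMassGapProblem := by
  intro h
  obtain ⟨G, _, _, _, _, _, _, _, _, N, ρ, hN, hρc, hinj, hunit, hnc, hΔ⟩ :=
    exists_finite_nonabelian_model
  obtain ⟨ξ, hξ, hdiv⟩ := h N G ρ hN hρc hinj hunit hnc
  obtain ⟨β₁, hβ₁⟩ := hdiv (2 / deltaG ρ + 1)
  -- a coupling beyond `β₁`, `1` and the Adhikari–Cao threshold
  obtain ⟨β, hβ1, hβone, hβthr⟩ : ∃ β : ℝ, β₁ ≤ β ∧ 1 ≤ β ∧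
      114 + 4 * Real.log (Fintype.card G) ≤ deltaG ρ * β := by
    refine ⟨max (max β₁ 1) ((114 + 4 * Real.log (Fintype.card G)) / deltaG ρ),
      le_trans (le_max_left _ _) (le_max_left _ _),
      le_trans (le_max_right _ _) (le_max_left _ _), ?_⟩
    have hthr : (114 + 4 * Real.log (Fintype.card G)) / deltaG ρ ≤
        max (max β₁ 1) ((114 + 4 * Real.log (Fintype.card G)) / deltaG ρ) := le_max_right _ _
    rw [div_le_iff₀ hΔ] at hthr
    linarith [mul_comm (max (max β₁ 1) ((114 + 4 * Real.log (Fintype.card G)) / deltaG ρ)) (deltaG ρ)]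
  have hβpos : 0 < β := lt_of_lt_of_le one_pos hβone
  obtain ⟨μ, hμ⟩ := exists_isInfiniteVolumeLimit_of_discrete G N ρ β
  obtain ⟨hξpos, hpos, hlim⟩ := hξ β hβpos μ hμ
  have hcpos : 0 < β / 2 * deltaG ρ := by positivity
  -- exponential upper bound along the axis in the infinite-volume limit
  have hup : ∀ n : ℕ, 2 ≤ n →
      |plaquetteCorrelation ρ μ (Pi.single (0 : Fin 4) (n : ℤ))| ≤
        4 * (4 * 10 ^ 24 * (Fintype.card G : ℝ) ^ 2) ^ 2 *
          Real.exp (-((β / 2 * deltaG ρ) * ((n : ℝ) - 2))) := by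
    intro n hn
    refine abs_plaquetteCorrelation_le_of_eventually G N ρ hρc β μ hμ
      (Pi.single (0 : Fin 4) (n : ℤ)) _ ?_
    filter_upwards [eventually_ge_atTop (n + 1)] with L hL
    have key := hB hAC G N ρ hunit β hβthr n hn L hL
    have e : Real.exp (-(β / 2) * deltaG ρ * ((n : ℝ) - 2)) =
        Real.exp (-((β / 2 * deltaG ρ) * ((n : ℝ) - 2))) := by ring_nf
    rw [e] at key
    exact key
  have hrate : β / 2 * deltaG ρ ≤ 1 / ξ β μ :=
    le_inv_corrLength_of_axial_decay (plaquetteCorrelation ρ μ) _ (β / 2 * deltaG ρ) (ξ β μ)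
      hcpos hξpos hup hpos hlim
  -- contradiction with divergence: ξ β μ ≥ 2/Δ + 1 > 2/(βΔ) = 1/c ≥ ξ β μ
  have hM : 2 / deltaG ρ + 1 ≤ ξ β μ := hβ₁ β hβ1 μ hμ
  have hξle : ξ β μ * (β / 2 * deltaG ρ) ≤ 1 := by
    have := (le_div_iff₀ hξpos).1 hrate
    linarith [mul_comm (β / 2 * deltaG ρ) (ξ β μ)]
  have h2 : 2 / deltaG ρ * (β / 2 * deltaG ρ) = β := by
    field_simp
  have hM' : (2 / deltaG ρ + 1) * (β / 2 * deltaG ρ) ≤ ξ β μ * (β / 2 * deltaG ρ) :=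
    mul_le_mul_of_nonneg_right hM hcpos.le
  rw [add_mul, h2, one_mul] at hM'
  linarith

end Summit.QuantumFields.YangMills.Theorems.NotChatterjeeMassGap

end
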